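import Literature.NumberTheory.EllipticCurves.FineSelmerRankEqualityRoad
import Literature.NumberTheory.SerreUniformity.Statement
import Mathlib.GroupTheory.Sylow
import Mathlib.GroupTheory.Perm.Cycle.Type
import Mathlib.LinearAlgebra.Matrix.Charpoly.FiniteField
import HarnessLib

/-!
# The rank-equality road at `(E, p)` for a `C_ns⁺(p)` image, ANY odd `p`: the inertia hypothesis `σ̄_m ∈ I(𝔮|p)` from `4 ∣ #I(𝔮|p)`

Topic `NumberTheory/EllipticCurves` (grouping sub-namespace `CoatesSujatha2005.RankEqualityRoad`, as its parent file).  THEOREM-ONLY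
(no definition, no named fact, no `sorry`); literature seat `bsd-potss-conjA-anchor` g23 (cell `bsd-potss`, `--supports
stmt-BirchSwinnertonDyer-19413`, stub `stub_fineA_tame_five_le`; closes nothing; neither BSD nor Conjecture A is booked for any curve).

The image-agnostic rank-equality road (k8t-c4 g25, `conjA_of_rankEq`: `E/ℚ`, `p` odd, `p ∤ #Gal(ℚ(E[p])/ℚ)`, basis data `σ_s ↦ S`
(first row `(1,0)`), `σ_m ↦ −1`, `σ_x ↦ X` (`X₀₁ ≠ 0`), and the layer-0 rank equality) displays the per-row inertia input
`hcI : σ̄_m ∈ I(𝔮)` for every prime `𝔮 ∋ p` of `L = ℚ(E[p])`.  For a `C_ns⁺(5)` image k8t-c4 g26 discharged `hcI` from the DETERMINANT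
(`FineSelmerRankEqualityNonsplitCartanFiveInertia`: an inertia element of determinant `2` has twelfth power `−1`).  That device needs a
unit `u ∈ 𝔽_pˣ` such that every element of `C_ns⁺(p)` of determinant `u` has a power equal to `−1`; for `p ≡ 3 (mod 4)` NO such `u` exists
(the scalars have square determinants, and a coset element `cτ` of determinant `u` has `(cτ)² = −u`, which generates a subgroup containing
`−1` only when `−u` has even order, i.e. when `u` is a square — e.g. at `p = 7`).  THIS FILE gives the replacement valid at every odd `p`:

* `exists_apply_eq_neg_one_of_four_dvd_card` — **finite group lemma**: if a finite group `G` embeds (`φ` injective) into the matrices of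
  `C_ns⁺(ε)` (`ε` a non-square of `𝔽_p`, `p` odd) and `4 ∣ #G`, then `φ g = −1` for some `g ∈ G`.  Proof: a subgroup `Q ≤ G` of order
  `4` (Sylow) is cyclic or of exponent `2`; the square of any element of `C_ns⁺(ε)` lies in `C_ns(ε)` (for the coset `(a, −εb; b, −a)` it is
  the scalar `a² − εb²`), and the only involution of Cartan shape `(x, εy; y, x)` is `−1` (`2xy = 0` and `x² + εy² = 1` force `y = 0`,
  `x = ±1`, since `ε` is not a square) — so an element of order `4` squares to `−1`; and two distinct involutions `≠ −1` are coset elements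
  whose product is a Cartan-shaped involution, hence `−1`;
* `neg_one_mem_inertia_of_four_dvd_card_inertia` — for `E/ℚ` with `Γ_ℚ` acting on `E[p]` through `C_ns⁺(ε)` in a frame `e` and
  `σ_m` acting as `−1`: if `4 ∣ #I(𝔮)` for a maximal `𝔮 ∋ p`... (any maximal `𝔮` of `𝓞 ℚ(E[p])`, in fact) then `σ̄_m ∈ I(𝔮)` — apply the
  group lemma to the faithful matrix representation of `Gal(ℚ(E[p])/ℚ)` (`exists_matrixRep_divisionField`) restricted to `I(𝔮)`;
* `conjA_of_rankEq_of_four_dvd_card_inertia` — g25's `conjA_of_rankEq` for a `C_ns⁺(ε)`-row with `hcI` replaced by the displayed,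
  EXACTLY computable datum `4 ∣ #I(𝔮|p)` (= `4 ∣ e(ℚ(E[p])/ℚ at p)`; for a Galois field all `I(𝔮|p)` are conjugate, and
  `#I(𝔮|p) = lcm of the ramification indices e(𝔓|p) over the primes 𝔓 of ℚ(P)`, the cyclic tame inertia acting faithfully on
  `E[p] ∖ 0 = G/Stab(P)`).  On the three `p = 7` rows of the K8-t′ table (`163072bq1/cb1/k1`, image `7Nn`, semistability defect `4`)
  this is the shape of the inertia input (census: conjA-anchor g23 kit «rankeq7»);
* `not_dvd_card_gal_of_nonsplitCartanNormalizer` — the road's other structural input `p ∤ #Gal(ℚ(E[p])/ℚ)` for a `C_ns⁺(ε)` image at ANY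
  odd `p` (k8t-c4 g26 has it at `p = 5` by `decide`): an element of order `p` of `GL₂(𝔽_p)` has trace `2` (`tr(M^p) = tr(M)^p`, Fermat)
  and determinant `1`, which no element of `C_ns⁺(ε)` other than `1` has (Cartan shape: `2a = 2`, `a² − εb² = 1`; coset shape: trace `0`);
  Cauchy's theorem.

## References

* J.-P. Serre, *Propriétés galoisiennes des points d'ordre fini des courbes elliptiques*, Invent. Math. 15 (1972), §2.2 (the groups
  `C_ns`, `N_ns`), §5.2. [Serre1972]
* J. Coates, R. Sujatha, *Fine Selmer groups of elliptic curves over p-adic Lie extensions*, Math. Ann. 331 (2005), §3 Thm. 3.4. [CoatesSujatha2005]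
* K. Iwasawa, *A note on class numbers of algebraic number fields*, Abh. Math. Sem. Hamburg 20 (1956). [Iwasawa1956]
-/

set_option autoImplicit false

noncomputable section

open scoped Classical NumberField Matrix
open WeierstrassCurve Field IntermediateField
  Literature.NumberTheory.GaloisRepresentations Literature.NumberTheory.SerreUniformity
  Literature.NumberTheory.IwasawaTheory
  Literature.NumberTheory.NumberFields

namespace Literature.NumberTheory.EllipticCurves.CoatesSujatha2005

namespace RankEqualityRoad

/-! ### §0 Matrix algebra in `C_ns⁺(ε) ≤ GL₂(𝔽_p)` -/

section MatrixAlgebra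

variable {p : ℕ} [Fact p.Prime]

/-- Product of two Cartan-shaped matrices `(a, εb; b, a)(c, εd; d, c)`. [folklore] -/
private theorem cartan_mul_cartan (ε a b c d : ZMod p) :
    (!![a, ε * b; b, a] : Matrix (Fin 2) (Fin 2) (ZMod p)) * !![c, ε * d; d, c]
      = !![a * c + ε * (b * d), ε * (a * d + b * c); a * d + b * c, a * c + ε * (b * d)] := by
  ext i j; fin_cases i <;> fin_cases j <;> simp [Matrix.mul_apply, Fin.sum_univ_two] <;> ring

/-- Product of two coset matrices `(a, −εb; b, −a)(c, −εd; d, −c)` is Cartan-shaped. [folklore] -/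
private theorem coset_mul_coset (ε a b c d : ZMod p) :
    (!![a, -(ε * b); b, -a] : Matrix (Fin 2) (Fin 2) (ZMod p)) * !![c, -(ε * d); d, -c]
      = !![a * c - ε * (b * d), ε * (b * c - a * d); b * c - a * d, a * c - ε * (b * d)] := by
  ext i j; fin_cases i <;> fin_cases j <;> simp [Matrix.mul_apply, Fin.sum_univ_two] <;> ring

/-- `2 ≠ 0` in `𝔽_p` for an odd prime `p`. [folklore] -/
private theorem two_ne_zero_zmod (hp2 : p ≠ 2) : (2 : ZMod p) ≠ 0 := by
  intro h
  have h' : ((2 : ℕ) : ZMod p) = 0 := by exact_mod_cast h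
  rw [ZMod.natCast_eq_zero_iff] at h'
  have := (Nat.prime_dvd_prime_iff_eq (Fact.out : p.Prime) Nat.prime_two).mp h'
  exact hp2 this

/-- **The only involutions of Cartan shape are `±1`.**  For `p` odd and `ε` a non-square of `𝔽_p`: if `N = (x, εy; y, x)` satisfies
`N² = 1` then `N = 1` or `N = −1` (`2xy = 0`; `x = 0` would make `ε = y⁻²` a square). [cite: Serre1972, §2.2] -/
private theorem cartan_eq_one_or_neg_one_of_sq_eq_one (hp2 : p ≠ 2) {ε : ZMod p} (hε : ¬ IsSquare ε) (x y : ZMod p)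
    (h : (!![x, ε * y; y, x] : Matrix (Fin 2) (Fin 2) (ZMod p)) * !![x, ε * y; y, x] = 1) :
    (!![x, ε * y; y, x] : Matrix (Fin 2) (Fin 2) (ZMod p)) = 1 ∨
      (!![x, ε * y; y, x] : Matrix (Fin 2) (Fin 2) (ZMod p)) = -1 := by
  rw [cartan_mul_cartan] at h
  have h10 : x * y + y * x = 0 := by
    have := congrFun (congrFun h 1) 0
    simpa using this
  have h00 : x * x + ε * (y * y) = 1 := by
    have := congrFun (congrFun h 0) 0
    simpa using this
  have hxy : x * y = 0 := by
    have h2 : (2 : ZMod p) * (x * y) = 0 := by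
      rw [two_mul]; simpa [mul_comm y x] using h10
    rcases mul_eq_zero.mp h2 with h2 | h2
    · exact absurd h2 (two_ne_zero_zmod hp2)
    · exact h2
  rcases mul_eq_zero.mp hxy with hx | hy
  · -- `x = 0`: `ε y² = 1`, so `ε` is a square — excluded
    exfalso
    apply hε
    rw [hx, zero_mul, zero_add] at h00
    have hy : y ≠ 0 := by
      rintro rfl
      simp at h00
    have : ε = (y * y)⁻¹ := eq_inv_of_mul_eq_one_left h00
    exact ⟨y⁻¹, by rw [this, mul_inv]⟩
  · -- `y = 0`: `x² = 1`
    rw [hy, mul_zero, mul_zero, add_zero] at h00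
    have hx : x = 1 ∨ x = -1 := by
      have hfac : (x - 1) * (x + 1) = 0 := by
        have : x * x - 1 = 0 := sub_eq_zero.mpr h00
        linear_combination this
      rcases mul_eq_zero.mp hfac with h1 | h1
      · exact Or.inl (sub_eq_zero.mp h1)
      · exact Or.inr (eq_neg_of_add_eq_zero_left h1)
    rcases hx with rfl | rfl
    · left
      ext i j; fin_cases i <;> fin_cases j <;> simp [hy]
    · right
      ext i j; fin_cases i <;> fin_cases j <;> simp [hy]

/-- The square of an element of `C_ns⁺(ε)` is Cartan-shaped (for a coset element it is the scalar `a² − εb²`). [cite: Serre1972, §2.2] -/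
private theorem exists_cartan_eq_mul_self {ε : ZMod p} {M : Matrix (Fin 2) (Fin 2) (ZMod p)}
    (hM : M ∈ nonsplitCartanNormalizer ε) : ∃ x y : ZMod p, M * M = !![x, ε * y; y, x] := by
  obtain ⟨a, b, -, rfl | rfl⟩ := hM
  · exact ⟨a * a + ε * (b * b), a * b + b * a, cartan_mul_cartan ε a b a b⟩
  · exact ⟨a * a - ε * (b * b), b * a - a * b, coset_mul_coset ε a b a b⟩

/-- In `C_ns⁺(ε)`: `M⁴ = 1` and `M² ≠ 1` force `M² = −1`. [cite: Serre1972, §2.2] -/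
private theorem mul_self_eq_neg_one_of_pow_four (hp2 : p ≠ 2) {ε : ZMod p} (hε : ¬ IsSquare ε)
    {M : Matrix (Fin 2) (Fin 2) (ZMod p)} (hM : M ∈ nonsplitCartanNormalizer ε)
    (h4 : M * M * (M * M) = 1) (h2 : M * M ≠ 1) : M * M = -1 := by
  obtain ⟨x, y, hxy⟩ := exists_cartan_eq_mul_self hM
  rw [hxy] at h4 h2 ⊢
  rcases cartan_eq_one_or_neg_one_of_sq_eq_one hp2 hε x y h4 with h | h
  · exact absurd h h2
  · exact h

/-- An involution of `C_ns⁺(ε)` other than `±1` is a coset element `(a, −εb; b, −a)`. [cite: Serre1972, §2.2] -/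
private theorem exists_coset_eq_of_mul_self_eq_one (hp2 : p ≠ 2) {ε : ZMod p} (hε : ¬ IsSquare ε)
    {M : Matrix (Fin 2) (Fin 2) (ZMod p)} (hM : M ∈ nonsplitCartanNormalizer ε)
    (h1 : M * M = 1) (hne : M ≠ 1) (hne' : M ≠ -1) : ∃ a b : ZMod p, M = !![a, -(ε * b); b, -a] := by
  obtain ⟨a, b, -, rfl | rfl⟩ := hM
  · rcases cartan_eq_one_or_neg_one_of_sq_eq_one hp2 hε a b h1 with h | h
    · exact absurd h hne
    · exact absurd h hne'
  · exact ⟨a, b, rfl⟩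

end MatrixAlgebra

/-! ### §1 The finite group lemma: a subgroup of `C_ns⁺(ε)` of order divisible by `4` contains `−1` -/

/-- **Group lemma.**  `p` an odd prime, `ε ∈ 𝔽_p` a non-square, `G` a finite group with an injective homomorphism `φ` into the `2 × 2`
matrices over `𝔽_p` whose values lie in `C_ns⁺(ε)`.  If `4 ∣ #G` then `φ g = −1` for some `g ∈ G`.  (A subgroup of order `4` is cyclic —
its generator squares to `−1` — or of exponent `2` — two distinct involutions `≠ −1` are coset elements and their product is a Cartan-shaped
involution `≠ 1`, i.e. `−1`.) [cite: Serre1972, §2.2 (structure of C_ns and its normaliser)] -/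
theorem exists_apply_eq_neg_one_of_four_dvd_card {p : ℕ} [Fact p.Prime] (hp2 : p ≠ 2) {ε : ZMod p} (hε : ¬ IsSquare ε)
    {G : Type*} [Group G] [Finite G] (φ : G →* Matrix (Fin 2) (Fin 2) (ZMod p)) (hφ : Function.Injective φ)
    (himg : ∀ g : G, φ g ∈ nonsplitCartanNormalizer ε) (h4 : 4 ∣ Nat.card G) : ∃ g : G, φ g = -1 := by
  haveI : Fact (Nat.Prime 2) := ⟨Nat.prime_two⟩
  obtain ⟨Q, hQ⟩ := Sylow.exists_subgroup_card_pow_prime (G := G) 2 (n := 2)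
    (by rw [show (2 : ℕ) ^ 2 = 4 by norm_num]; exact h4)
  -- every element of `Q` has fourth power `1`
  have hq4 : ∀ q : Q, (q : G) ^ 4 = 1 := fun q => by
    have h : q ^ Nat.card Q = 1 := pow_card_eq_one'
    rw [hQ] at h
    have := congrArg (Subtype.val : Q → G) h
    simpa using this
  have hinj1 : ∀ g : G, φ g = 1 → g = 1 := fun g hg => hφ (by rw [hg, map_one])
  by_cases hex : ∃ q : Q, (q : G) * q ≠ 1
  · -- `Q` has an element of order `4`: its square maps to `−1`
    obtain ⟨q, hq⟩ := hex
    refine ⟨(q : G) * q, ?_⟩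
    rw [map_mul]
    refine mul_self_eq_neg_one_of_pow_four hp2 hε (himg q) ?_ ?_
    · rw [← map_mul, ← map_mul]
      have : (q : G) * q * ((q : G) * q) = (q : G) ^ 4 := by
        simp only [pow_succ, pow_zero, one_mul, mul_assoc]
      rw [this, hq4 q, map_one]
    · intro h
      exact hq (hinj1 _ (by rw [map_mul, h]))
  · -- `Q` has exponent `2`
    push Not at hex
    haveI : Fintype Q := Fintype.ofFinite Q
    have hcardQ : Fintype.card Q = 4 := by rw [← Nat.card_eq_fintype_card, hQ]; norm_num
    -- an element `g ≠ 1` of `Q`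
    have hnt : Nontrivial Q := by
      rw [← Fintype.one_lt_card_iff_nontrivial, hcardQ]; norm_num
    obtain ⟨g, hg1⟩ := exists_ne (1 : Q)
    -- an element `h ∉ {1, g}` of `Q`
    obtain ⟨h, -, hh⟩ : ∃ h : Q, h ∈ (Finset.univ : Finset Q) ∧ h ∉ ({1, g} : Finset Q) := by
      apply Finset.exists_mem_notMem_of_card_lt_card
      calc ({1, g} : Finset Q).card ≤ 2 := Finset.card_le_two
        _ < 4 := by norm_num
        _ = (Finset.univ : Finset Q).card := by rw [Finset.card_univ, hcardQ]
    simp only [Finset.mem_insert, Finset.mem_singleton, not_or] at hh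
    obtain ⟨hh1, hhg⟩ := hh
    -- the three involutions `φ g`, `φ h`, `φ (g h)`
    by_cases hgm : φ g = -1
    · exact ⟨g, hgm⟩
    by_cases hhm : φ h = -1
    · exact ⟨h, hhm⟩
    have hgsq : φ (g : G) * φ (g : G) = 1 := by rw [← map_mul, hex g, map_one]
    have hhsq : φ (h : G) * φ (h : G) = 1 := by rw [← map_mul, hex h, map_one]
    have hgne : φ (g : G) ≠ 1 := fun h' => hg1 (Subtype.ext (hinj1 _ h'))
    have hhne : φ (h : G) ≠ 1 := fun h' => hh1 (Subtype.ext (hinj1 _ h'))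
    obtain ⟨a, b, hab⟩ := exists_coset_eq_of_mul_self_eq_one hp2 hε (himg g) hgsq hgne hgm
    obtain ⟨c, d, hcd⟩ := exists_coset_eq_of_mul_self_eq_one hp2 hε (himg h) hhsq hhne hhm
    refine ⟨(g : G) * h, ?_⟩
    have hprod : φ ((g : G) * h) = !![a * c - ε * (b * d), ε * (b * c - a * d); b * c - a * d, a * c - ε * (b * d)] := by
      rw [map_mul, hab, hcd, coset_mul_coset]
    have hsq : φ ((g : G) * h) * φ ((g : G) * h) = 1 := by
      rw [← map_mul]
      have : ((g : G) * h) * ((g : G) * h) = ((g * h : Q) : G) * (g * h : Q) := by simp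
      rw [this, hex (g * h), map_one]
    rw [hprod] at hsq ⊢
    rcases cartan_eq_one_or_neg_one_of_sq_eq_one hp2 hε _ _ hsq with h1 | h1
    · -- `φ (g h) = 1` would give `h = g⁻¹ = g`
      exfalso
      have hgh : (g : G) * h = 1 := hinj1 _ (by rw [hprod, h1])
      have hg2 : (g : G) * g = 1 := hex g
      have : (h : G) = g := by
        calc (h : G) = (g : G) * g * h := by rw [hg2, one_mul]
          _ = g := by rw [mul_assoc, hgh, mul_one]
      exact hhg (Subtype.ext this)
    · exact h1

/-! ### §2 The inertia input of the rank-equality road from `4 ∣ #I(𝔮)` -/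

/-- Two matrices acting alike on all `e P` coincide (`e` onto). [folklore] -/
private theorem matrix_eq_of_forall_mulVec₅ {A : Type*} [AddCommGroup A] {n : ℕ} (e : A ≃+ (Fin 2 → ZMod n))
    {M N : Matrix (Fin 2) (Fin 2) (ZMod n)} (h : ∀ P : A, M *ᵥ e P = N *ᵥ e P) : M = N := by
  have h' : ∀ v, M *ᵥ v = N *ᵥ v := fun v => by simpa using h (e.symm v)
  ext i j
  have := congrFun (h' (Pi.single j 1)) i
  simpa [Matrix.mulVec_single] using this

/-- Restriction `Γ_F → Gal(E/F)` is onto. [folklore] -/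
private theorem absRestrictNormalHom_surjective₅ {F : Type} [Field F] (E : IntermediateField F (AlgebraicClosure F))
    [Normal F E] : Function.Surjective (absRestrictNormalHom E) := fun g => by
  obtain ⟨σ, hσ⟩ := AlgEquiv.restrictNormalHom_surjective (AlgebraicClosure F) g
  exact ⟨(Field.absoluteGaloisGroup.toAlgEquiv F).symm σ, hσ⟩

/-- **`σ̄_m ∈ I(𝔮)` from `4 ∣ #I(𝔮)`.**  `E/ℚ` elliptic, `p` an odd prime, `Γ_ℚ` acting on `E[p]` in the additive frame `e` through
`C_ns⁺(ε)` (`ε` a non-square), `σ_m ∈ Γ_ℚ` acting as `−1`.  If the inertia group `I(𝔮) ≤ Gal(ℚ(E[p])/ℚ)` of a maximal ideal `𝔮` of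
`𝓞 ℚ(E[p])` has order divisible by `4`, then the restriction of `σ_m` lies in `I(𝔮)`: the faithful matrix representation of
`Gal(ℚ(E[p])/ℚ)` in the frame `e` (`exists_matrixRep_divisionField`) embeds `I(𝔮)` into `C_ns⁺(ε)`, and §1 produces an element of `I(𝔮)`
acting as `−1`, which is `σ̄_m` by faithfulness. [cite: Serre1972, §2.2 and §5.2] -/
theorem neg_one_mem_inertia_of_four_dvd_card_inertia (W : WeierstrassCurve ℚ) [W.IsElliptic] (p : ℕ) [Fact p.Prime] (hp2 : p ≠ 2)
    (e : W.geomTorsion (p : ℕ) ≃+ (Fin 2 → ZMod p)) {ε : ZMod p} (hε : ¬ IsSquare ε)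
    (he : ∀ σ : absoluteGaloisGroup ℚ, ∃ M ∈ nonsplitCartanNormalizer ε, ∀ P : W.geomTorsion (p : ℕ), e (σ • P) = M *ᵥ e P)
    (σm : absoluteGaloisGroup ℚ) (hσm : ∀ P : W.geomTorsion (p : ℕ), e (σm • P) = -e P)
    (𝔮 : Ideal (𝓞 ↥(W.divisionField p))) [𝔮.IsMaximal]
    (h4 : 4 ∣ Nat.card (𝔮.inertia (↥(W.divisionField p) ≃ₐ[ℚ] ↥(W.divisionField p)))) :
    absRestrictNormalHom (W.divisionField p) σm ∈ 𝔮.inertia (↥(W.divisionField p) ≃ₐ[ℚ] ↥(W.divisionField p)) := by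
  haveI : NeZero p := ⟨(Fact.out : p.Prime).ne_zero⟩
  -- the faithful matrix representation of `Gal(ℚ(E[p])/ℚ)` in the basis `e`
  obtain ⟨ρm, hρm, hρme⟩ := exists_matrixRep_divisionField W p e
  have hmat : ∀ (σ : absoluteGaloisGroup ℚ) (M : Matrix (Fin 2) (Fin 2) (ZMod p)),
      (∀ P, e (σ • P) = M *ᵥ e P) → ρm (absRestrictNormalHom _ σ) = M :=
    fun σ M hM => matrix_eq_of_forall_mulVec₅ e fun P => by rw [← hρme, hM]
  set I : Subgroup (↥(W.divisionField p) ≃ₐ[ℚ] ↥(W.divisionField p)) :=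
    𝔮.inertia (↥(W.divisionField p) ≃ₐ[ℚ] ↥(W.divisionField p)) with hI
  -- `ρm` restricted to `I(𝔮)`
  let φ : I →* Matrix (Fin 2) (Fin 2) (ZMod p) := ρm.comp I.subtype
  have hφ : Function.Injective φ := hρm.comp Subtype.val_injective
  have himg : ∀ g : I, φ g ∈ nonsplitCartanNormalizer ε := fun g => by
    obtain ⟨σ, hσ⟩ := absRestrictNormalHom_surjective₅ (W.divisionField p) g.1
    obtain ⟨M, hM, hMe⟩ := he σ
    have hφg : φ g = M := by
      show ρm g.1 = M
      rw [← hσ]; exact hmat σ M hMe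
    rw [hφg]; exact hM
  obtain ⟨g, hg⟩ := exists_apply_eq_neg_one_of_four_dvd_card hp2 hε φ hφ himg h4
  have hσm' : ρm (absRestrictNormalHom _ σm) = -1 :=
    hmat σm (-1) fun P => by rw [hσm P, Matrix.neg_mulVec, Matrix.one_mulVec]
  have heq : absRestrictNormalHom (W.divisionField p) σm = g.1 :=
    hρm (by rw [hσm']; exact hg.symm)
  rw [heq]
  exact g.2

/-! ### §3 Statement (A) at `(E, p)` for a `C_ns⁺(p)`-row from the rank equality and `4 ∣ #I(𝔮|p)` -/

/-- **(A) at `(E, p)` for a non-split-Cartan-normaliser image from the rank equality, inertia input `4 ∣ #I(𝔮|p)`.**  `E/ℚ`, `p` odd,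
`p ∤ #Gal(ℚ(E[p])/ℚ)`; `Γ_ℚ` acts on `E[p]` in the frame `e` through `C_ns⁺(ε)` (`ε` a non-square); basis data `σ_s ↦ S` (first row
`(1,0)`), `σ_m ↦ −1`, `σ_x ↦ X` (`X₀₁ ≠ 0`); the layer-0 rank equality `#Cl(L^⟨σ̄_s⟩)[p] = #Cl(L^⟨σ̄_m, σ̄_s⟩)[p]` (`hrank`); and
`4 ∣ #I(𝔮)` for every maximal `𝔮 ∋ p` of `𝓞 ℚ(E[p])` (`h4` — one exactly computable number, the ramification index of `ℚ(E[p])/ℚ` at `p`).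
Then the dual fine Selmer group of `E` over `ℚ_cyc` is finitely generated over `ℤ_p` for every cyclotomic `ℤ_p`-extension: g25's
`conjA_of_rankEq` with `hcI` supplied by §2. [cite: CoatesSujatha2005, §3 Thm. 3.4 and Lemma 3.8] [cite: Iwasawa1956, §§3–5]
[cite: Serre1972, §2.2 and §5.2] -/
theorem conjA_of_rankEq_of_four_dvd_card_inertia (W : WeierstrassCurve ℚ) [W.IsElliptic] {p : ℕ} [Fact p.Prime] (hp2 : p ≠ 2)
    (hG : ¬ p ∣ Nat.card (↥(W.divisionField p) ≃ₐ[ℚ] ↥(W.divisionField p)))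
    (e : W.geomTorsion p ≃+ (Fin 2 → ZMod p)) {ε : ZMod p} (hε : ¬ IsSquare ε)
    (he : ∀ σ : absoluteGaloisGroup ℚ, ∃ M ∈ nonsplitCartanNormalizer ε, ∀ P : W.geomTorsion p, e (σ • P) = M *ᵥ e P)
    (σs σm σx : absoluteGaloisGroup ℚ)
    {S : Matrix (Fin 2) (Fin 2) (ZMod p)} (hS0 : S 0 0 = 1) (hS1 : S 0 1 = 0)
    (hσs : ∀ P : W.geomTorsion p, e (σs • P) = S *ᵥ e P)
    (hσm : ∀ P : W.geomTorsion p, e (σm • P) = -e P)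
    {X : Matrix (Fin 2) (Fin 2) (ZMod p)} (hX : X 0 1 ≠ 0) (hσx : ∀ P : W.geomTorsion p, e (σx • P) = X *ᵥ e P)
    (hrank : Nat.card {d : ClassGroup (𝓞 ↥(fixedField (Subgroup.zpowers (absRestrictNormalHom (W.divisionField p) σs)))) // d ^ p = 1} =
      Nat.card {d : ClassGroup (𝓞 ↥(fixedField (Subgroup.zpowers (absRestrictNormalHom (W.divisionField p) σm) ⊔
        Subgroup.zpowers (absRestrictNormalHom (W.divisionField p) σs)))) // d ^ p = 1})
    (h4 : ∀ (𝔮 : Ideal (𝓞 ↥(W.divisionField p))) [𝔮.IsMaximal], ((p : ℕ) : 𝓞 ↥(W.divisionField p)) ∈ 𝔮 →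
      4 ∣ Nat.card (𝔮.inertia (↥(W.divisionField p) ≃ₐ[ℚ] ↥(W.divisionField p))))
    (κ : ZpExtension ℚ p) (hκ : κ.IsCyclotomic) :
    ∃ (γ : absoluteGaloisGroup ℚ) (D : W.FineSelmerDualData κ γ),
      Module.Finite ℤ_[p] (RestrictScalars ℤ_[p] (IwasawaAlgebra p) D.X) :=
  conjA_of_rankEq W hp2 hG e σs σm σx hS0 hS1 hσs hσm hX hσx hrank
    (fun 𝔮 _ h𝔮 => neg_one_mem_inertia_of_four_dvd_card_inertia W p hp2 e hε he σm hσm 𝔮 (h4 𝔮 h𝔮)) κ hκ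

/-! ### §4 The structural input `p ∤ #Gal(ℚ(E[p])/ℚ)` for a `C_ns⁺(ε)` image, any odd `p` -/

section OrderP

variable {p : ℕ} [Fact p.Prime]

/-- No element of `C_ns⁺(ε)` other than `1` has `p`-th power `1` (`p` odd, `ε` a non-square): such an element has trace `2` and
determinant `1`. [cite: Serre1972, §2.2] -/
private theorem eq_one_of_pow_prime_eq_one (hp2 : p ≠ 2) {ε : ZMod p} (hε : ¬ IsSquare ε)
    {M : Matrix (Fin 2) (Fin 2) (ZMod p)} (hM : M ∈ nonsplitCartanNormalizer ε) (h : M ^ p = 1) : M = 1 := by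
  have htr : M.trace = 2 := by
    have h1 := ZMod.trace_pow_card M
    rw [h, ZMod.pow_card, Matrix.trace_one, Fintype.card_fin] at h1
    exact_mod_cast h1.symm
  have hdet : M.det = 1 := by
    have h1 : (M ^ p).det = 1 := by rw [h, Matrix.det_one]
    rwa [Matrix.det_pow, ZMod.pow_card] at h1
  have hε0 : ε ≠ 0 := by rintro rfl; exact hε ⟨0, (mul_zero 0).symm⟩
  obtain ⟨a, b, -, rfl | rfl⟩ := hM
  · -- Cartan shape: trace `2a = 2`, determinant `a² − εb² = 1`
    have ha : a = 1 := by
      have h2 : a + a = 2 := by simpa [Matrix.trace_fin_two] using htr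
      have h3 : (2 : ZMod p) * (a - 1) = 0 := by linear_combination h2
      rcases mul_eq_zero.mp h3 with h3 | h3
      · exact absurd h3 (two_ne_zero_zmod hp2)
      · exact sub_eq_zero.mp h3
    subst ha
    have hb : b = 0 := by
      have h2 : 1 * 1 - ε * b * b = 1 := by simpa [Matrix.det_fin_two] using hdet
      have h3 : ε * (b * b) = 0 := by linear_combination -h2
      rcases mul_eq_zero.mp h3 with h3 | h3
      · exact absurd h3 hε0
      · exact mul_self_eq_zero.mp h3
    subst hb
    ext i j; fin_cases i <;> fin_cases j <;> simp
  · -- coset shape: trace `0`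
    exfalso
    have h2 : (a + -a : ZMod p) = 2 := by simpa [Matrix.trace_fin_two] using htr
    rw [add_neg_cancel] at h2
    exact two_ne_zero_zmod hp2 h2.symm

end OrderP

/-- **`p ∤ #Gal(ℚ(E[p])/ℚ)` for a `C_ns⁺(ε)` image, any odd `p`.**  `E/ℚ` elliptic with `Γ_ℚ` acting on `E[p]` in a frame `e` through
`C_ns⁺(ε)` (`ε` a non-square).  Then `p` does not divide the order of `Gal(ℚ(E[p])/ℚ)`: an element of order `p` (Cauchy) would act by a
matrix of `C_ns⁺(ε)` with `p`-th power `1`, i.e. trivially, contradicting faithfulness. (k8t-c4 g26's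
`not_five_dvd_card_gal_of_nonsplitCartanNormalizer` is the case `p = 5`.) [cite: Serre1972, §2.2] -/
theorem not_dvd_card_gal_of_nonsplitCartanNormalizer (W : WeierstrassCurve ℚ) [W.IsElliptic] (p : ℕ) [Fact p.Prime] (hp2 : p ≠ 2)
    (e : W.geomTorsion (p : ℕ) ≃+ (Fin 2 → ZMod p)) {ε : ZMod p} (hε : ¬ IsSquare ε)
    (he : ∀ σ : absoluteGaloisGroup ℚ, ∃ M ∈ nonsplitCartanNormalizer ε, ∀ P : W.geomTorsion (p : ℕ), e (σ • P) = M *ᵥ e P) :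
    ¬ p ∣ Nat.card (↥(W.divisionField p) ≃ₐ[ℚ] ↥(W.divisionField p)) := by
  haveI : NeZero p := ⟨(Fact.out : p.Prime).ne_zero⟩
  intro hdvd
  obtain ⟨ρm, hρm, hρme⟩ := exists_matrixRep_divisionField W p e
  have hmat : ∀ (σ : absoluteGaloisGroup ℚ) (M : Matrix (Fin 2) (Fin 2) (ZMod p)),
      (∀ P, e (σ • P) = M *ᵥ e P) → ρm (absRestrictNormalHom _ σ) = M :=
    fun σ M hM => matrix_eq_of_forall_mulVec₅ e fun P => by rw [← hρme, hM]
  obtain ⟨g, hg⟩ := exists_prime_orderOf_dvd_card' p hdvd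
  obtain ⟨σ, hσ⟩ := absRestrictNormalHom_surjective₅ (W.divisionField p) g
  obtain ⟨M, hM, hMe⟩ := he σ
  have hρg : ρm g = M := by rw [← hσ]; exact hmat σ M hMe
  have hordM : orderOf M = p := by
    rw [← hρg, orderOf_injective ρm hρm g]; exact hg
  have hMp : M ^ p = 1 := by
    have h1 := pow_orderOf_eq_one M
    rw [hordM] at h1
    exact h1
  have hM1 : M = 1 := eq_one_of_pow_prime_eq_one hp2 hε hM hMp
  have hg1 : g = 1 := hρm (by rw [hρg, hM1]; exact (map_one ρm).symm)
  have : orderOf g = 1 := by rw [hg1, orderOf_one]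
  rw [hg] at this
  exact (Fact.out : p.Prime).one_lt.ne' this

end RankEqualityRoad

end Literature.NumberTheory.EllipticCurves.CoatesSujatha2005

end
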